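import Summits.ResolutionOfSingularities.ResolutionOfSingularities.Theorems.DeltaCutSepCertificates5
import HarnessLib

/-!
# DeltaCutRefCertificates — decomp-res node «RefCut (certificates)» (lens-6 g27, critic row 204 CLEARED (F-curve
WHOLE) DECIDED +1 · MAP 0), tree file 1/5 of the node

Content VERBATIM from the decomp-res lens-6 g27 node's certificate file
`HOME/decomp-res-lens-6/g27/RefCutCertificates.lean` (pin 745ed495, 1525 l; HOME = run/shared/lean/pub/decomp-res;
companion of `RefCut.lean` df7099b8 = `Theorems/DeltaCutRef*` / `DeltaCutRefCells`): ring level only — imports the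
landed `Theorems.DeltaCutSepCertificates5` (g26, writer g12) + `HarnessLib`, uses
`Rescue.BedZpeBinom4Centre.mul_mem_pow_add` by an explicit `open … (mul_mem_pow_add)` (the g26 dedup ruling); every
declaration is new, namespace `…Theorems.DeltaCutClasses`, one section `RefCertificates` (`open MvPolynomial`,
`variable {K : Type*} [Field K]`), no `private` helpers, no `def`s.  Farm (lens + critic): rc 0 · 0 err · 0 warn · 0
sorry; axioms std (`bc/ProbeCert.lean` 9c9249c3, HOME-only).  Critic: CRITIC-LEDGER row 204 «RefCut» CLEARED
(F-curve WHOLE) DECIDED +1 · MAP 0 — C× = `z³ + t⁴ + u⁴·w⁴` (char 3), the g26 kind-F inhabitant (separating run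
FROZEN at height 0, `Cx_sepFrozen_certificate`), is CERTIFIED DECIDED under the refined separating law at refined
height 4 (one closure-resolution round = 2 hops, then 2 separating hops), ALL charts, level-generic, in the g23–g26
certificate format + ONE new dictionary line (E) étale-local coordinates; the seven LEVEL CERTIFICATES close the
file.  Landing orders = NEXT-g28.md (8e7949e1) §4 (F) + critic rider INBOX :1315: `DeltaCutRefCertificates` / `…2` /
`…3` … = the file cut at the tree's 400-line cap at declaration boundaries (the plan's PART A+B | C | D boundaries
are ≈ 610 / 495 / 420 lines, each over the cap, so the cap decides; each part re-opens `section RefCertificates`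
with the same `variable` / `open` header; the section docstring (dictionary) travels with part 1); all VERBATIM,
`--kind proof --supports stmt-ResolutionOfSingularities-26971`, no `maxHeartbeats`, the HOME-only
dupNamespace-linter line dropped.

The lens header, verbatim:

> # RefCutCertificates — decomp-res node «RefCut» (lens-6 g27, critic row 196): KERNEL CERTIFICATES of the refined cut
>
> C× = `z³ + t⁴ + u⁴·w⁴` (char 3) — the g26 kind-F inhabitant (`Cx_sepFrozen_certificate`: separating run FROZEN at
height 0) — is
> CERTIFIED DECIDED under the REFINED separating law of `RefCut.lean` (refined height 4: one closure-resolution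
round = 2 hops, then 2
> separating hops), at the polynomial level, ALL charts, level-generic, in the g23–g26 certificate format and dictionary (file
> `DeltaCutSepCertificates`: (ord) `∃ s ∉ 𝔮, s·g ∈ 𝔮^m`; WILD = `3`-power form; NEAR = transform `∈ 𝔫'³` with a
generic cofactor; TAME =
> order-2 differential operator extracting `c·e`, `e` a regular parameter; (L) Rees charts of coordinate linear
centres `linChartSubst`;
> (R) coordinate linear subspaces (and disjoint unions of them) are regular, `V(z,t,u·w)` is not regular at the
origin) plus ONE new
> dictionary line: (E) ÉTALE-LOCAL COORDINATES — at a prime `𝔮 ∋ h(x₁)` with `h' ∉ 𝔮` (`h ∈ K[x₁]`), `(x₀, h, x₂,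
x₃)` is a regular
> system of parameters of the completed local ring and every order / top / tame / wild / near / chart statement for
`g(x₀, h, x₂, x₃)`
> at `𝔮` is the corresponding statement for `g(X₀, X₁, X₂, X₃)` (machine-checked part: the identity `g = aeval (X₀,
h, X₂, X₃) P∞` and the
> separability `h ∈ 𝔮 → h' ∉ 𝔮`).  Coordinates `0 = z, 1 = t, 2 = u, 3 = w` (renamed per chart in the docstrings).
>
> Provenance: HOME = run/shared/lean/pub/decomp-res, lens-6 g27 (unit decomp-res-lens-6-g27), desk NEXT-g27.md §6
(8773dc1d) now certified;
> `--supports stmt-ResolutionOfSingularities-26971`.  Namespace `…Theorems.DeltaCutClasses`, section `RefCertificates`.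
>
> (Sources: Hironaka1967; CossartJannsenSaito2020 Def. 3.13 / Thm. 3.14, Ch. 8, Thm. 9.6; Hironaka1970;
CossartPiltant2019 Prop. 2.6;
> CossartPiltant2008 §2; Giraud1975; Hironaka2005; EGAIV4 §16–§18 (18.4 étale-local structure); StacksProject 0804 /
0BIQ / 031I / 039P;
> Matsumura1987 §28–§30; Kollar2007 Thm. 1.101.)

## This file

§RefCertificates — KERNEL CERTIFICATES of the refined cut for C× = `z³ + t⁴ + u⁴·w⁴` (char 3; coordinates `0 = z, 1
= t, 2 = u, 3 = w`): PART A — R0 (`Cx_sing_closure`, `Cx_closure_not_prime`, `Cx_symm`, `Cx_R0_certificate`: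
Sing(closure bad₀) = {origin}, the refined hop at R0 is the point blow-up); PART B — the point-blow-up charts
(strict closure regular / carried lines, tops, exits); PART C — charts `u` and `b` of the separating hops after the
exit (étale-local coordinates (E)); PART D + the seven LEVEL CERTIFICATES (refined height 4: C× DECIDED).  (The
400-line cap cuts this group into 5 files; this first part carries: `Cx_sing_closure`, `Cx_symm`, `Cx_A_chart_z`,
`Cx_A_chart_t`, `Cx_A_chart_u`, `Cx_A_chart_z_noTop`, `Cx_A_chart_t_noTop`.)

[WRITER NOTE (decomp-res writer g13): file split only (tree files ≤ 400 lines, cut at declaration boundaries);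
namespace, the section `RefCertificates` with its `open MvPolynomial` / `variable {K : Type*} [Field K]`, and every
declaration exactly as in the lens (the HOME-only dupNamespace-linter line is dropped — the library sets it;
`noncomputable section`, the file-level `open` lines, `universe u` and `open …Rescue.BedZpeBinom4Centre
(mul_mem_pow_add)` are replayed in every part).]

(Sources: Hironaka1967; CossartJannsenSaito2020 Def. 3.13 / Thm. 3.14, Ch. 8, Thm. 9.6; Hironaka1970;
CossartPiltant2019 Prop. 2.6; CossartPiltant2008 §2; Giraud1975; Hironaka2005; EGAIV4 §16–§18; StacksProject 0804 /
0BIQ / 031I / 039P; Matsumura1987 §28–§30; Kollar2007 Thm. 1.101.)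
-/

noncomputable section

open CategoryTheory CategoryTheory.Limits AlgebraicGeometry TopologicalSpace IsLocalRing
open Literature.AlgebraicGeometry.Resolution

universe u

open Summit.ResolutionOfSingularities.ResolutionOfSingularities.Theorems.Rescue.BedZpeBinom4Centre (mul_mem_pow_add)

namespace Summit.ResolutionOfSingularities.ResolutionOfSingularities.Theorems.DeltaCutClasses

open Summit.ResolutionOfSingularities.ResolutionOfSingularities.Theorems.TwistCutClasses
open Summit.ResolutionOfSingularities.ResolutionOfSingularities.Theorems.LightCutClasses

section RefCertificates

open MvPolynomial
variable {K : Type*} [Field K]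

/-! ### §RefCertificates — C× UNDER THE REFINED LAW (char 3), LEVEL BY LEVEL

REFINED RUN OF C× = `(𝔸⁴_k, (z³ + t⁴ + u⁴w⁴), 3)`, `k` any field of characteristic `3` (letter binders of
`WORTopSepHeavy 3` addressed
exactly as for P∞/C_ax/B_S/C× in `DeltaCutSepCertificates` — `IsBase`: affine 4-space; `IsDatum 3`: `D_z^{(3)} f = 1`; the three
heaviness binders: the origin is a closed WILD top point with a NEAR point which is BAD (`Cx_axes`); `¬
RunTerminates`: level 0 of
the canonical bad run is INFINITE (all closed points of two lines: g25 kind A); `¬ SepTerminates`: `Cx_sepFrozen_certificate`):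
* R0 (pending `none`): bad₀ = all closed points of `C := V(z,t,u·w)` (`Cx_top`, `Cx_axes`), closure `C` NOT regular
  (`Cx_closure_not_prime`) and of dimension `1` (two lines): `CurveFrozen` ⇒ the refined hop RESOLVES: centre = `Sing C = {0}`
  (`Cx_sing_closure`: `P_u + P_w = 𝔫₀`, the two regular lines meet exactly at the origin), pending := `C̃` = strict transform of `C`.
* R0 → R1, the point blow-up (PRE-STEP A; `chartSubst`): chart `z`: `1 + z(t'⁴ + z⁴u'⁴w'⁴)` NO top point (`Cx_A_chart_z`,
  `Cx_A_chart_z_noTop`); chart `t`: `z'³ + t(1 + t⁴u'⁴w'⁴)` NO top point (`Cx_A_chart_t`, `Cx_A_chart_t_noTop`); chart `u`: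
  `g_u = z'³ + u·t'⁴ + u⁵·w'⁴` (`Cx_A_chart_u`): top = `ℓ_u ∪ ũ`, `ℓ_u = V(z',t',u) ⊆ E₁` (`w'` free), `ũ =
V(z',t',w')` = `C̃ ∩` chart
  (`Cx_A_chart_u_top`: `z', t' ∈ 𝔮` and `u ∈ 𝔮 ∨ w' ∈ 𝔮`; `Cx_A_chart_u_lines`: `g_u ∈ P_ℓ³ ∩ P_ũ³`, both LINES,
`g_u = z'³ + r`,
  `r ∈ P_ℓ⁵ ∩ P_ũ⁴`: WILD at EVERY point of both; NEAR everywhere: `Cx_A_near`); chart `w`: by the symmetry `u ↔ w` (`Cx_symm`).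
  So top₁ = bad₁ = `ũ ∪ L ∪ w̃`, `L := {z = t = 0} ⊆ E₁ ≅ ℙ³` (`L ∩` chart `u = ℓ_u`), a NODAL CHAIN: `closure bad₁` is NOT regular
  at `O_u = ℓ_u ∩ ũ` (`P_ℓ ⊓ P_ũ = (z', t', u·w')`: the SAME non-prime ideal as `Cx_closure_not_prime`) — the
MEMORYLESS rule «blow up
  `Sing(closure bad)` and recompute» would freeze/node forever here (Probe MS); the refined law instead reads its
MEMORY: pending =
  `C̃ = ũ ⊔ w̃`, two DISJOINT coordinate lines — REGULAR (R) ⇒ R1 → R2 is the EXIT hop: blow up `𝓘(C̃)`, pending := `none`.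
* R1 → R2, the line blow-up of `ũ = V(z',t',w')` in chart-`u` coordinates (PRE-STEP B; `linChartSubst {0,1,3}`): chart `z'`:
  `1 + z'u(t''⁴ + u⁴w''⁴)` NO top point (`Cx_B_lineChart_X0`, `_noTop`); chart `t'`: `a³ + t'u(1 + u⁴b⁴)` NO top point
  (`Cx_B_lineChart_X1`, `_noTop`: where `1 + u⁴b⁴ = 0` it is a regular parameter); chart `w'`: `g₂ = a³ + u·w'·(b⁴ + u⁴)`
  (`Cx_B_lineChart_X3`; coordinates `a, b, u, w' = X0, X1, X2, X3`): top = the line `m = V(a,b,u)` (`w'` free) =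
strict transform of
  `ℓ_u` (`Cx_B_lineChart_X3_top`: `a, b, u ∈ 𝔮`; `Cx_B_lineChart_X3_line`: `g₂ ∈ P_m³`, `w' ∉ P_m`, `g₂ = a³ + r`,
`r ∈ P_m⁵`: WILD and
  NEAR (the generic form of `Cx_A_near`) at EVERY point of `m`).  Off `ũ ⊔ w̃` level 1 is unchanged (`L ∖ {O_u,
O_w}` bad).  So top₂ = bad₂ = `L̃` (strict
  transform of `L`; `L̃ ∩` chart `w' = m`, a coordinate line in each chart: REGULAR (R)), nothing pending, bad₂ ≠ ∅,
closure regular: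
  R2 is SEPARATING-ACTIVE ⇒ R2 → R3 is g26's `sepHop`: step 1 = blow up `L̃`, step 2 = `T₂ ∖ closure bad₂ = ∅` (empty centre).
* R2 → R3, the line blow-up of `L̃ = V(a,b,u)` in chart-`w'` coordinates (`linChartSubst {0,1,2}`): chart `a`: `1 +
a²u w'(b⁴+u⁴)` NO
  top point (`Cx_C_lineChart_X0`, `_noTop`); chart `u`: `g₃ = α³ + u²·w'·h(β)`, `h = β⁴ + 1` (`Cx_C_lineChart_X2`; coordinates
  `α, β, u, w' = X0, X1, X2, X3`): top = `λ ∪ μ`, `λ = V(α,u,w')` (`β` free: a line in the fibre of `E` over `R =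
(w' = 0) ∈ L̃`),
  `μ = V(α,u,h)` (`w'` free) (`Cx_C_lineChart_X2_top`: `α, u ∈ 𝔮` and `w' ∈ 𝔮 ∨ h ∈ 𝔮`; `Cx_C_curves`: `g₃ ∈ P_λ³ ∩
(α,u,h)³`, `β ∉ P_λ`,
  `w' ∉ (α,u,h)`); TAME along `λ ∖ {h = 0}` and along `μ ∖ {w' = 0}` (`Cx_C_dd`: `∂_u∂_u g₃ = 2·(w'·h)`;
`Cx_C_tame_lambda`, `Cx_C_tame_mu`:
  `w'·h` a regular parameter there — `h` is SEPARABLE: `Cx_h_separable`); WILD with a NEAR point at the points `Q =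
λ ∩ μ = V(α,u,w',h)`
  (`Cx_C_wild_near_Q`) — FINITELY many closed points (`h ≠ 0` univariate).  KEY (`Cx_C_isPinf`): `g₃ = P∞(α, h(β),
u, w')` LITERALLY
  (`aeval`), and wherever `h' = β³ ∉ 𝔮` (all of `μ`, and `λ ∖ {β = 0}`; `Cx_h_separable`) dictionary (E) applies:
the germ of R3 at `Q` IS
  P∞'s germ at its origin, `λ`, `μ` = P∞'s `s`- and `w`-axes.  Chart `b`: `g₃' = α³ + b²·γ·w'·(1 + γ⁴)`
(`Cx_C_lineChart_X1`; coordinates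
  `α, b, γ, w' = X0, X1, X2, X3`; `γ = β⁻¹` on the overlap) carries ONE MORE top curve, invisible in chart `u`: top
= `ν ∪ λ ∪ μ`,
  `ν = V(α,b,γ)` (`w'` free: the section `β = ∞` of `E → L̃` — the direction of `ũ`; the degree-5 form
`u·w'·(b⁴+u⁴)` of `g₂` vanishes
  at FIVE directions `u·(b⁴+u⁴) = 0` of the plane `a = 0`) (`Cx_C_lineChart_X1_top`: `α, b ∈ 𝔮` and `γ ∈ 𝔮 ∨ w' ∈ 𝔮 ∨ 1+γ⁴ ∈ 𝔮`;
  `Cx_C_nu_lines`: `g₃' ∈ P_ν³ ∩ P_{λ}³`, both lines); TAME along `ν ∖ {w' = 0}` (`Cx_C_dd_b`: `∂_b∂_b g₃' = 2·(γ·w'·(1+γ⁴))`,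
  `Cx_C_tame_nu`); WILD with a NEAR point at `Q₀ = ν ∩ λ` = the origin of chart `b` (`Cx_C_wild_near_Q0`, point
chart `b` checked by
  `chartSubst`); and AGAIN P∞ (`Cx_C_isPinf_b`): `g₃' = P∞(α, γ·(1+γ⁴), b, w')` LITERALLY, `γ(1+γ⁴)` an étale
coordinate along `ν`
  (`Cx_gamma_separable`: its derivative `1 + 5γ⁴ ∉ 𝔮 ∋ γ`), `λ`, `ν` = P∞'s `s`- and `w`-axes at `Q₀`.  The `w̃`
side is the mirror image
  (`Cx_symm`).  So top₃ = `λ ∪ λ' ∪ (μ ∪ ν)` (`μ ∪ ν`: five horizontal sections over `L̃ ≅ ℙ¹`, a finite ÉTALE cover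
— distinct directions
  at every point — hence a regular projective curve), bad₃ = `{Q} ∪ {Q₀} ∪ mirror`: FINITE, NONEMPTY, closure
regular ⇒ R3 → R4 is again
  g26's `sepHop`: step 1 = blow up the bad points, step 2 = the strict transform of `T₃ ∖ bad₃`: `λ̃ ⊔ λ̃' ⊔ (μ ∪
ν)~`, pairwise DISJOINT
  regular curves (they met only at the bad points, with DISTINCT tangents — P∞'s two axes) ⇒ `OldTopRegular`, step 2 FIRES.
* R3 → R4: over each `Q` and `Q₀` this is LITERALLY P∞'s deciding separating hop (`Pinf_perpetual_certificate`
(R)/(U)/(Z) for step 1,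
  `Pinf_sepHeightOne_certificate` for step 2, read through (E)): NO bad point over `Q`, `Q₀`.  Off those fibres:
along `λ ∖ {Q, Q₀}`
  (`h` a unit; chart `u` covers `λ ∖ Q₀`) the line charts of `V(α,u,w')` (`linChartSubst {0,2,3}` on `g₃`): chart
`u`: `α'³ + w''·h` NO
  top point (`Cx_D_lineChart_X2`, `_noTop`); chart `w'`: `α'³ + u'²·h` top points only where `h ∈ 𝔮`, i.e. over `Q`
  (`Cx_D_lineChart_X3`, `_top`); chart `α`: `1 + u'²w''h` NO top point (`Cx_D_lineChart_X0`, `_noTop`); along `μ ∖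
Q` and `ν ∖ Q₀`
  (`w'` a unit): by (E) these are P∞'s TAME `w`-axis points `(0,0,0,c)`, `c ≠ 0`, whose step-2 line charts are
  `Pinf_sepHeightOne_certificate`'s (via `Pinf_symm`) — cross-checked polynomially: `μ`-chart `h` (`Cx_D_muChart_h`:
`g₃(αh, β, uh, w') =
  h³·(α³ + u²w')`, `Cx_D_muChart_h_top`: top only where `w' ∈ 𝔮`), `ν`-charts `b`, `α`, `γ`
(`Cx_D_nuChart_X1/X0/X2`, `_top`/`_noTop`:
  top only where `w' ∈ 𝔮` (over `Q₀`) or `1+γ⁴ ∈ 𝔮` (on `μ`, away from `ν`)).  Points on no centre keep their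
(non-top / tame) type.  So
  bad₄ = ∅ (top₄ ≠ ∅: tame curves remain, as for P∞): `RefTerminates 3 ⟨(𝔸⁴, (C×)), none⟩` at refined height 4 — C×
is g26-RESIDUAL
  (kind F) and g27-DECIDED; it is neither F-surface nor P′.  The level certificates: `Cx_R0_certificate`,
`Cx_R1_certificate`, `Cx_R2_certificate`, `Cx_R3u_certificate`,
  `Cx_R3b_certificate`, `Cx_R4_certificate`, `Cx_R4nu_certificate`. ∎ -/

/-! #### Level R0 — the frozen closure `C = V(z,t,u·w)` and its singular point -/

/-- **C× — `Sing(closure bad₀) = {origin}`**: the two (regular, coordinate) lines `V(P_u)`, `V(P_w)` of the closure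
meet EXACTLY at the
origin: `P_u ⊔ P_w = 𝔫₀ = (z,t,u,w)`.  With `Cx_closure_not_prime` (not regular AT the origin) and (R) (regular off
it): the resolving
centre of the refined hop at R0 is the origin. [new; elementary] [folklore] -/
theorem Cx_sing_closure :
    Ideal.span {(X 0 : MvPolynomial (Fin 4) K), X 1, X 3} ⊔ Ideal.span {(X 0 : MvPolynomial (Fin 4) K), X 1, X 2} =
      Ideal.span {(X 0 : MvPolynomial (Fin 4) K), X 1, X 2, X 3} := by
  apply le_antisymm
  · refine sup_le (Ideal.span_le.2 ?_) (Ideal.span_le.2 ?_)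
    · intro g hg
      simp only [Set.mem_insert_iff, Set.mem_singleton_iff] at hg
      rcases hg with rfl | rfl | rfl
      · exact X_mem_spanX4 0
      · exact X_mem_spanX4 1
      · exact X_mem_spanX4 3
    · intro g hg
      simp only [Set.mem_insert_iff, Set.mem_singleton_iff] at hg
      rcases hg with rfl | rfl | rfl
      · exact X_mem_spanX4 0
      · exact X_mem_spanX4 1
      · exact X_mem_spanX4 2
  · refine Ideal.span_le.2 ?_
    intro g hg
    simp only [Set.mem_insert_iff, Set.mem_singleton_iff] at hg
    rcases hg with rfl | rfl | rfl | rfl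
    · exact Ideal.mem_sup_left (Ideal.subset_span (by simp))
    · exact Ideal.mem_sup_left (Ideal.subset_span (by simp))
    · exact Ideal.mem_sup_right (Ideal.subset_span (by simp))
    · exact Ideal.mem_sup_left (Ideal.subset_span (by simp))

/-- **C× is symmetric under `u ↔ w`** (every chart-`w` / `w̃`-side statement is the chart-`u` / `ũ`-side statement
with `2 ↔ 3`).
[elementary] [folklore] -/
theorem Cx_symm :
    rename (Equiv.swap (2 : Fin 4) 3) (X 0 ^ 3 + X 1 ^ 4 + X 2 ^ 4 * X 3 ^ 4 : MvPolynomial (Fin 4) K) =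
      X 0 ^ 3 + X 1 ^ 4 + X 2 ^ 4 * X 3 ^ 4 := by
  simp [rename_X, Equiv.swap_apply_def]; ring

/-! #### R0 → R1 — PRE-STEP A: the blow-up of the origin (`chartSubst`) -/

/-- chart `z`: `f(z, t'z, u'z, w'z) = z³·(1 + z·(t'⁴ + z⁴·u'⁴·w'⁴))`. [new; elementary] [folklore] -/
theorem Cx_A_chart_z :
    aeval (chartSubst (K := K) 0) (X 0 ^ 3 + X 1 ^ 4 + X 2 ^ 4 * X 3 ^ 4 : MvPolynomial (Fin 4) K) =
      X 0 ^ 3 * (1 + X 0 * (X 1 ^ 4 + X 0 ^ 4 * X 2 ^ 4 * X 3 ^ 4)) := by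
  simp [chartSubst]; ring

/-- chart `t`: `f(z't, t, u't, w't) = t³·(z'³ + t·(1 + t⁴·u'⁴·w'⁴))`. [new; elementary] [folklore] -/
theorem Cx_A_chart_t :
    aeval (chartSubst (K := K) 1) (X 0 ^ 3 + X 1 ^ 4 + X 2 ^ 4 * X 3 ^ 4 : MvPolynomial (Fin 4) K) =
      X 1 ^ 3 * (X 0 ^ 3 + X 1 * (1 + X 1 ^ 4 * X 2 ^ 4 * X 3 ^ 4)) := by
  simp [chartSubst]; ring

/-- chart `u`: `f(z'u, t'u, u, w'u) = u³·(z'³ + u·t'⁴ + u⁵·w'⁴)` =: `u³·g_u`. [new; elementary] [folklore] -/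
theorem Cx_A_chart_u :
    aeval (chartSubst (K := K) 2) (X 0 ^ 3 + X 1 ^ 4 + X 2 ^ 4 * X 3 ^ 4 : MvPolynomial (Fin 4) K) =
      X 2 ^ 3 * (X 0 ^ 3 + X 2 * X 1 ^ 4 + X 2 ^ 5 * X 3 ^ 4) := by
  simp [chartSubst]; ring

/-- **chart `z` — NO top point**: `1 + z(t'⁴ + z⁴u'⁴w'⁴)` has no prime of order `≥ 3` (`∂_{t'}`: `z·t'³ ∈ 𝔮`;
`∂_{u'}`: `z⁵u'³w'⁴ ∈ 𝔮`;
then `1 ∈ 𝔮`). [new; elementary] [folklore] -/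
theorem Cx_A_chart_z_noTop [CharP K 3] (𝔮 : Ideal (MvPolynomial (Fin 4) K)) [𝔮.IsPrime] {s : MvPolynomial (Fin 4) K} (hs : s ∉ 𝔮)
    (h : s * (1 + X 0 * (X 1 ^ 4 + X 0 ^ 4 * X 2 ^ 4 * X 3 ^ 4) : MvPolynomial (Fin 4) K) ∈ 𝔮 ^ 3) : False := by
  have hs2 : s ^ 2 ∉ 𝔮 := pow_not_mem 𝔮 hs 2
  have h4 : (4 : MvPolynomial (Fin 4) K) ∉ 𝔮 := by
    have := natCast_not_mem (K := K) 𝔮 (m := 4) (by decide)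
    exact_mod_cast this
  have e10 := f_ne K (i := 1) (j := 0) (by decide)
  have e12 := f_ne K (i := 1) (j := 2) (by decide)
  have e13 := f_ne K (i := 1) (j := 3) (by decide)
  have e20 := f_ne K (i := 2) (j := 0) (by decide)
  have e21 := f_ne K (i := 2) (j := 1) (by decide)
  have e23 := f_ne K (i := 2) (j := 3) (by decide)
  have e11 := f_self K 1
  have e22 := f_self K 2
  have d1 : pderiv 1 (1 + X 0 * (X 1 ^ 4 + X 0 ^ 4 * X 2 ^ 4 * X 3 ^ 4) : MvPolynomial (Fin 4) K) = 4 * (X 0 * X 1 ^ 3) := by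
    simp only [map_add, Derivation.leibniz, Derivation.leibniz_pow, smul_eq_mul, nsmul_eq_mul, e10, e11, e12, e13, f_one]
    push_cast; ring
  have d2 : pderiv 2 (1 + X 0 * (X 1 ^ 4 + X 0 ^ 4 * X 2 ^ 4 * X 3 ^ 4) : MvPolynomial (Fin 4) K) =
      4 * (X 0 ^ 5 * X 3 ^ 4 * X 2 ^ 3) := by
    simp only [map_add, Derivation.leibniz, Derivation.leibniz_pow, smul_eq_mul, nsmul_eq_mul, e20, e21, e22, e23, f_one]
    push_cast; ring
  have hf : (1 + X 0 * (X 1 ^ 4 + X 0 ^ 4 * X 2 ^ 4 * X 3 ^ 4) : MvPolynomial (Fin 4) K) ∈ 𝔮 := mem_of_sMul_mem_cube 𝔮 hs h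
  have key : (X 0 * (X 1 ^ 4 + X 0 ^ 4 * X 2 ^ 4 * X 3 ^ 4) : MvPolynomial (Fin 4) K) ∈ 𝔮 := by
    have h1 := sq_mul_deriv_mem_pow 𝔮 h (pderiv 1)
    rw [d1] at h1
    have h01 : (X 0 * X 1 ^ 3 : MvPolynomial (Fin 4) K) ∈ 𝔮 := by
      have := Ideal.pow_le_self two_ne_zero h1
      rcases ‹𝔮.IsPrime›.mem_or_mem this with h' | h'
      · exact absurd h' hs2
      rcases ‹𝔮.IsPrime›.mem_or_mem h' with h'' | h''
      · exact absurd h'' h4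
      · exact h''
    rcases ‹𝔮.IsPrime›.mem_or_mem h01 with h0 | h1'
    · exact Ideal.mul_mem_right _ _ h0
    have hX1 : (X 1 : MvPolynomial (Fin 4) K) ∈ 𝔮 := ‹𝔮.IsPrime›.mem_of_pow_mem 3 h1'
    have h2 := sq_mul_deriv_mem_pow 𝔮 h (pderiv 2)
    rw [d2] at h2
    have h023 : (X 0 ^ 5 * X 3 ^ 4 * X 2 ^ 3 : MvPolynomial (Fin 4) K) ∈ 𝔮 := by
      have := Ideal.pow_le_self two_ne_zero h2
      rcases ‹𝔮.IsPrime›.mem_or_mem this with h' | h'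
      · exact absurd h' hs2
      rcases ‹𝔮.IsPrime›.mem_or_mem h' with h'' | h''
      · exact absurd h'' h4
      · exact h''
    have hsum : (X 1 ^ 4 + X 0 ^ 4 * X 2 ^ 4 * X 3 ^ 4 : MvPolynomial (Fin 4) K) ∈ 𝔮 := by
      refine Ideal.add_mem _ (Ideal.pow_mem_of_mem 𝔮 hX1 4 (by norm_num)) ?_
      rcases ‹𝔮.IsPrime›.mem_or_mem h023 with h' | h'
      · rcases ‹𝔮.IsPrime›.mem_or_mem h' with h'' | h''
        · exact Ideal.mul_mem_right _ _ (Ideal.mul_mem_right _ _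
            (Ideal.pow_mem_of_mem 𝔮 (‹𝔮.IsPrime›.mem_of_pow_mem 5 h'') 4 (by norm_num)))
        · exact Ideal.mul_mem_left _ _ (‹𝔮.IsPrime›.mem_of_pow_mem 4 h'' |> fun h3 => Ideal.pow_mem_of_mem 𝔮 h3 4 (by norm_num))
      · exact Ideal.mul_mem_right _ _ (Ideal.mul_mem_left _ _
          (Ideal.pow_mem_of_mem 𝔮 (‹𝔮.IsPrime›.mem_of_pow_mem 3 h') 4 (by norm_num)))
    exact Ideal.mul_mem_left _ _ hsum
  have h1mem : (1 : MvPolynomial (Fin 4) K) ∈ 𝔮 := by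
    have := Ideal.sub_mem _ hf key
    rwa [add_sub_cancel_right] at this
  exact one_not_mem_of_isPrime 𝔮 h1mem

/-- **chart `t` — NO top point**: `z'³ + t(1 + t⁴u'⁴w'⁴)` has no prime of order `≥ 3` (`∂_t`: `1 + 5t⁴u'⁴w'⁴ ∈ 𝔮`; `∂_{u'}`:
`t⁵u'³w'⁴ ∈ 𝔮` ⟹ `t ∈ 𝔮 ∨ u' ∈ 𝔮 ∨ w' ∈ 𝔮` ⟹ `1 ∈ 𝔮`). [new; elementary] [folklore] -/
theorem Cx_A_chart_t_noTop [CharP K 3] (𝔮 : Ideal (MvPolynomial (Fin 4) K)) [𝔮.IsPrime] {s : MvPolynomial (Fin 4) K} (hs : s ∉ 𝔮)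
    (h : s * (X 0 ^ 3 + X 1 * (1 + X 1 ^ 4 * X 2 ^ 4 * X 3 ^ 4) : MvPolynomial (Fin 4) K) ∈ 𝔮 ^ 3) : False := by
  have hs2 : s ^ 2 ∉ 𝔮 := pow_not_mem 𝔮 hs 2
  have h4 : (4 : MvPolynomial (Fin 4) K) ∉ 𝔮 := by
    have := natCast_not_mem (K := K) 𝔮 (m := 4) (by decide)
    exact_mod_cast this
  have e10 := f_ne K (i := 1) (j := 0) (by decide)
  have e12 := f_ne K (i := 1) (j := 2) (by decide)
  have e13 := f_ne K (i := 1) (j := 3) (by decide)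
  have e20 := f_ne K (i := 2) (j := 0) (by decide)
  have e21 := f_ne K (i := 2) (j := 1) (by decide)
  have e23 := f_ne K (i := 2) (j := 3) (by decide)
  have e11 := f_self K 1
  have e22 := f_self K 2
  have d1 : pderiv 1 (X 0 ^ 3 + X 1 * (1 + X 1 ^ 4 * X 2 ^ 4 * X 3 ^ 4) : MvPolynomial (Fin 4) K) =
      1 + 5 * (X 1 ^ 4 * X 2 ^ 4 * X 3 ^ 4) := by
    simp only [map_add, Derivation.leibniz, Derivation.leibniz_pow, smul_eq_mul, nsmul_eq_mul, e10, e11, e12, e13, f_one]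
    push_cast; ring
  have d2 : pderiv 2 (X 0 ^ 3 + X 1 * (1 + X 1 ^ 4 * X 2 ^ 4 * X 3 ^ 4) : MvPolynomial (Fin 4) K) =
      4 * (X 1 ^ 5 * X 3 ^ 4 * X 2 ^ 3) := by
    simp only [map_add, Derivation.leibniz, Derivation.leibniz_pow, smul_eq_mul, nsmul_eq_mul, e20, e21, e22, e23, f_one]
    push_cast; ring
  have h1 := sq_mul_deriv_mem_pow 𝔮 h (pderiv 1)
  rw [d1] at h1
  have hA : (1 + 5 * (X 1 ^ 4 * X 2 ^ 4 * X 3 ^ 4) : MvPolynomial (Fin 4) K) ∈ 𝔮 :=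
    (‹𝔮.IsPrime›.mem_or_mem (Ideal.pow_le_self two_ne_zero h1)).resolve_left hs2
  have h2 := sq_mul_deriv_mem_pow 𝔮 h (pderiv 2)
  rw [d2] at h2
  have hB : (X 1 ^ 5 * X 3 ^ 4 * X 2 ^ 3 : MvPolynomial (Fin 4) K) ∈ 𝔮 := by
    have := Ideal.pow_le_self two_ne_zero h2
    rcases ‹𝔮.IsPrime›.mem_or_mem this with h' | h'
    · exact absurd h' hs2
    rcases ‹𝔮.IsPrime›.mem_or_mem h' with h'' | h''
    · exact absurd h'' h4
    · exact h''
  have hprod : (X 1 ^ 4 * X 2 ^ 4 * X 3 ^ 4 : MvPolynomial (Fin 4) K) ∈ 𝔮 := by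
    rcases ‹𝔮.IsPrime›.mem_or_mem hB with h' | h'
    · rcases ‹𝔮.IsPrime›.mem_or_mem h' with h'' | h''
      · exact Ideal.mul_mem_right _ _ (Ideal.mul_mem_right _ _
          (Ideal.pow_mem_of_mem 𝔮 (‹𝔮.IsPrime›.mem_of_pow_mem 5 h'') 4 (by norm_num)))
      · exact Ideal.mul_mem_left _ _ (Ideal.pow_mem_of_mem 𝔮 (‹𝔮.IsPrime›.mem_of_pow_mem 4 h'') 4 (by norm_num))
    · exact Ideal.mul_mem_right _ _ (Ideal.mul_mem_left _ _
        (Ideal.pow_mem_of_mem 𝔮 (‹𝔮.IsPrime›.mem_of_pow_mem 3 h') 4 (by norm_num)))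
  have h1mem : (1 : MvPolynomial (Fin 4) K) ∈ 𝔮 := by
    have := Ideal.sub_mem _ hA (Ideal.mul_mem_left _ 5 hprod)
    rwa [add_sub_cancel_right] at this
  exact one_not_mem_of_isPrime 𝔮 h1mem

end RefCertificates

end Summit.ResolutionOfSingularities.ResolutionOfSingularities.Theorems.DeltaCutClasses
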